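import Literature.Probability.Percolation.DiagonalBoxCrossing
import Literature.Probability.Percolation.CornerPercolation
import Literature.Probability.LatticeModels.IsoradialPercolationProofs
import HarnessLib

/-!
# Stub `stub_diagW_one` (crux stmt-CriticalPhenomena-5476 `UniformBoxCrossing`, line `Sketch`):
# the `t = 1` endpoint — w-crossings of the turned `2m × m` boxes of `ℤ²`

At `t = 1` the corner percolation model `M_1 = cornerPercolation 1` is Bernoulli bond percolation
on `ℤ²` at `p = 1/2` (`cornerPercolation_one`), which is also the canonical isoradial measure of
the square lattice (`RhombicEmbedding.isoradialPercolation_squareLattice_holds`). For the latter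
the tree has the uniform lower bound for left–right crossings of the `45°`-turned `2m × m` boxes
(diamond coordinates `zDia = col + hgt · i`) at every integer position,
`TrackExchange.diag_lr_lower` (Grimmett–Manolescu 2014, §6.2 with §2.3; Grimmett 1999, §11.7).

* `stub_diagW_one` — the registered stub: `∃ c > 0, ∃ m₀, ∀ m ≥ m₀, ∀ A B,
  c ≤ M_1 (embRectCrossing (zDia - (A + B i)) (2m) m)`; proof: rewrite the measure and apply
  `diag_lr_lower`.
-/

noncomputable section

namespace Summit.CriticalPhenomena.CardyFormulaZ2.Cruxes.UniformBoxCrossing.NonSlantLine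

open MeasureTheory Complex Literature.Probability.Percolation Literature.Probability.LatticeModels
open Literature.Probability.Percolation.TrackExchange

/-- `M_1` is the canonical isoradial bond percolation measure of the square lattice: both are
`P_{1/2}` bond percolation on `ℤ²` (`cornerPercolation_one`,
`RhombicEmbedding.isoradialPercolation_squareLattice_holds`). [folklore] -/
theorem cornerPercolation_one_eq_isoradialPercolation :
    cornerPercolation 1 = squareLatticeEmbedding.isoradialPercolation := by
  rw [cornerPercolation_one]
  exact RhombicEmbedding.isoradialPercolation_squareLattice_holds.symm

/-- **Stub 2: the `t = 1` endpoint (w-crossings of turned `2m × m` boxes).** At `t = 1` the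
corner model is `P_{1/2}` bond percolation on `ℤ²` (`cornerPercolation_one`,
`RhombicEmbedding.isoradialPercolation_squareLattice_holds`), whose turned `2m × m` boxes are
crossed the long way with probability `≥ c` uniformly in `m ≥ m₀` and in the position
(`TrackExchange.diag_lr_lower`, Grimmett–Manolescu 2014 §6.2 / Grimmett 1999 §11.7). [folklore] -/
theorem stub_diagW_one :
    ∃ c : ℝ, 0 < c ∧ ∃ m₀ : ℕ, ∀ m : ℕ, m₀ ≤ m → ∀ A B : ℤ,
      c ≤ (cornerPercolation 1).real (embRectCrossing (fun v => zDia v - ((A : ℂ) + (B : ℂ) * I)) (2 * m) m) := by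
  obtain ⟨c, hc, m₀, h⟩ := diag_lr_lower
  refine ⟨c, hc, m₀, fun m hm A B => ?_⟩
  rw [cornerPercolation_one_eq_isoradialPercolation]
  exact h m hm A B

end Summit.CriticalPhenomena.CardyFormulaZ2.Cruxes.UniformBoxCrossing.NonSlantLine

end
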